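import Mathlib

/-!
# Sketch (ideator 4, round 2) — first lemma of the crux idea `two-ordinary-typed-patching`
for crux stmt-Langlands-15110 `TwoAdicBianchiProModularityLevel` (E2′).

**Hida purity, step 1 (contraction of associated primes).**  The ordinary line reads the Artin
point off Hida's nearly-ordinary Hecke algebra `𝕋 := 𝕋^{ord}(U^2)_𝔪`, a commutative
`Λ`-subalgebra of `End_Λ(H)` acting faithfully on the finitely generated `Λ`-module
`H := H₁^{ord}(U^2)_𝔪` of ordinary completed homology (`Λ = 𝒪⟦T(ℤ₂)⟧`, commutative, regular).
Purity ("every irreducible component of `Spec 𝕋` has dimension `dim Λ − l₀`, `l₀ = 1`") is the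
chain

  minimal prime `𝔮 ⊂ 𝕋`  ⟹  `𝔮 ∈ Ass_𝕋(H)` (faithful + finite, Mathlib
  `minimalPrimes_annihilator_subset_associatedPrimes`)  ⟹  `𝔮 ∩ Λ ∈ Ass_Λ(H)` (THIS FILE)
  ⟹  `ht(𝔮 ∩ Λ) = pd_Λ H = 1` (Auslander–Buchsbaum for `H = coker(Λ^a ↪ Λ^a)`, the length-one
  perfect ordinary complex in the free Bianchi range `[q₀, q₀ + l₀] = [1, 2]`; not in Mathlib)
  ⟹  `dim 𝕋/𝔮 = dim Λ/(𝔮 ∩ Λ) = dim Λ − 1` (`𝕋` finite over `Λ`).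

The two theorems below are the Mathlib-level content of the first two arrows; they are stated over
arbitrary commutative rings (`Λ → T`, a `T`-module `M` regarded as a `Λ`-module through the tower).
-/

set_option linter.dupNamespace false

namespace Summit.Langlands.Langlands.Cruxes.TwoAdicBianchiProModularityLevel.Ideator4

open Submodule

/-- **Associated primes contract along the structure map.**  If `P ⊂ T` is an associated prime of
the `T`-module `M` and the `Λ`-module structure of `M` factors through `algebraMap Λ T`, then
`P ∩ Λ` is an associated prime of `M` as a `Λ`-module (same witness `x : M`: the `Λ`-annihilator
of `x` is the contraction of its `T`-annihilator, and radicals commute with contraction). -/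
theorem isAssociatedPrime_comap_algebraMap {Λ T M : Type*} [CommRing Λ] [CommRing T]
    [Algebra Λ T] [AddCommGroup M] [Module T M] [Module Λ M] [IsScalarTower Λ T M]
    {P : Ideal T} (hP : IsAssociatedPrime P M) :
    IsAssociatedPrime (P.comap (algebraMap Λ T)) M := by
  obtain ⟨hprime, x, hx⟩ := hP
  refine ⟨Ideal.comap_isPrime (algebraMap Λ T) P, x, ?_⟩
  rw [hx, Ideal.comap_radical]
  congr 1
  ext a
  simp only [Ideal.mem_comap, mem_colon_singleton, mem_bot, algebraMap_smul]

/-- **Hida purity, step 1.**  Let `T` be a commutative noetherian `Λ`-algebra acting faithfully on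
a finite `T`-module `M` (e.g. `T = 𝕋^{ord}_𝔪 ⊂ End_Λ(H₁^{ord})`).  Then every minimal prime of
`T` contracts to an associated prime of `M` over `Λ`.  (With Auslander–Buchsbaum this forces all
irreducible components of `Spec T` to have the same dimension `dim Λ − pd_Λ M`.) -/
theorem minimalPrime_comap_isAssociatedPrime {Λ T M : Type*} [CommRing Λ] [CommRing T]
    [Algebra Λ T] [IsNoetherianRing T] [AddCommGroup M] [Module T M] [Module.Finite T M]
    [Module Λ M] [IsScalarTower Λ T M]
    (hfaithful : Module.annihilator T M = ⊥) {𝔮 : Ideal T}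
    (h𝔮 : 𝔮 ∈ (⊥ : Ideal T).minimalPrimes) :
    IsAssociatedPrime (𝔮.comap (algebraMap Λ T)) M := by
  apply isAssociatedPrime_comap_algebraMap
  have hsub := Module.associatedPrimes.minimalPrimes_annihilator_subset_associatedPrimes T M
  rw [hfaithful] at hsub
  exact hsub h𝔮

end Summit.Langlands.Langlands.Cruxes.TwoAdicBianchiProModularityLevel.Ideator4
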